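import Literature.Analysis.SpecialFunctions.GaussianRiemannSums
import Mathlib.Analysis.SpecialFunctions.Trigonometric.Bounds
import Mathlib.Analysis.Real.Pi.Bounds
import Mathlib.Algebra.BigOperators.Ring.Finset
import Mathlib.Algebra.BigOperators.Intervals
import Mathlib.Data.ZMod.Basic

/-!
# One-dimensional Riemann-sum bounds for the free Wilson heat kernel
(helper for item stmt-QuantumFields-8877, `FreeKernelPowerCounting`, route HeatSlicedQuarks)

Elementary estimates, uniform in the torus side `L ≥ 1`, for the momentum sums that control the free
on-site heat kernel `L⁻⁴ Σ_k e^{−t h(k)}` of `D₀ᴴD₀` on `(ℤ/L)⁴` after it is factorised over the four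
coordinates:

* `sum_zmod_exp_upper` — for `1 ≤ t ≤ L²`: `Σ_{j : ZMod L} e^{−4t sin²(π j.val/L)} ≤ 2L/√t`
  (Jordan's inequality `sin x ≥ 2x/π` on both halves of the period and the Gaussian Riemann sum
  `Σ_{m ≥ 1} e^{−s m²} ≤ √π/(2√s)` of `Literature.Analysis.SpecialFunctions.sum_range_exp_neg_sq_succ_le`);
* `sum_zmod_exp_lower` — for `1 ≤ t`: `e^{−2} L/(2π√t) ≤ Σ_{j : ZMod L} e^{−t g(2π j.val/L)}` with
  `g(θ) = 4(1 − cos θ)² + sin² θ ≤ θ⁴ + θ²` (the `⌊L/(2π√t)⌋ + 1` momenta with `θ ≤ 1/√t` each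
  contribute at least `e^{−2}`);
* `sum_torus_prod_eq_pow` — `Σ_{k : (ℤ/L)⁴} Π_μ F(k_μ) = (Σ_j F j)⁴`.

References: standard calculus (Jordan's inequality, integral test); proved here from Mathlib.
Pure theorem file (no definitions).
-/

namespace Summit.QuantumFields.QCD.Theorems.HeatSlicedQuarks.FreeKernel

open Real Finset

noncomputable section

/-! ### Sums over `ZMod L` and over the four-torus -/

/-- A sum over `ZMod L` is the sum over the representatives `0, …, L − 1`. -/
theorem sum_zmod_eq_sum_range {L : ℕ} [NeZero L] {β : Type*} [AddCommMonoid β] (f : ZMod L → β) :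
    ∑ x : ZMod L, f x = ∑ m ∈ Finset.range L, f (m : ZMod L) := by
  refine (Finset.sum_nbij' (fun m : ℕ => (m : ZMod L)) (fun x : ZMod L => x.val) ?_ ?_ ?_ ?_ ?_).symm
  · intro m _; exact Finset.mem_univ _
  · intro x _; exact Finset.mem_range.mpr (ZMod.val_lt x)
  · intro m hm; exact ZMod.val_cast_of_lt (Finset.mem_range.mp hm)
  · intro x _; exact ZMod.natCast_zmod_val x
  · intro m _; rfl

/-- **Factorisation over the four coordinates**: `Σ_{k : (ℤ/L)⁴} Π_μ F(k_μ) = (Σ_j F j)⁴`. -/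
theorem sum_torus_prod_eq_pow {L : ℕ} [NeZero L] (F : ZMod L → ℝ) :
    ∑ k : Fin 4 → ZMod L, ∏ μ, F (k μ) = (∑ j : ZMod L, F j) ^ 4 := by
  rw [Finset.sum_pow', Fintype.piFinset_univ]

/-! ### The Gaussian Riemann sum -/

/-- **Gaussian Riemann sum**: for `s > 0` and every `N`, `Σ_{m<N} e^{−s (m+1)²} ≤ √π/(2√s)`. -/
theorem sum_range_exp_neg_mul_sq_succ_le {s : ℝ} (hs : 0 < s) (N : ℕ) :
    ∑ m ∈ Finset.range N, Real.exp (-(s * ((m : ℝ) + 1) ^ 2)) ≤ √π / (2 * √s) := by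
  have h := Literature.Analysis.SpecialFunctions.sum_range_exp_neg_sq_succ_le (Real.sqrt_pos.2 hs) N
  refine le_of_eq_of_le (Finset.sum_congr rfl fun m _ => ?_) h
  rw [mul_pow, Real.sq_sqrt hs.le]

/-! ### Upper bound: Jordan's inequality on both halves of the period -/

/-- For `0 ≤ v ≤ L`, `0 < L`: `e^{−4t sin²(πv/L)} ≤ e^{−16 t v²/L²} + e^{−16 t (L−v)²/L²}` for `t ≥ 0`
(`sin(πv/L) ≥ 2v/L` if `v ≤ L/2`, `sin(πv/L) = sin(π(L−v)/L) ≥ 2(L−v)/L` otherwise). -/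
theorem exp_neg_sin_sq_le {L v t : ℝ} (hL : 0 < L) (hv0 : 0 ≤ v) (hvL : v ≤ L) (ht : 0 ≤ t) :
    Real.exp (-(4 * t * Real.sin (π * v / L) ^ 2)) ≤
      Real.exp (-(16 * t * v ^ 2 / L ^ 2)) + Real.exp (-(16 * t * (L - v) ^ 2 / L ^ 2)) := by
  have hpos1 := Real.exp_pos (-(16 * t * v ^ 2 / L ^ 2))
  have hpos2 := Real.exp_pos (-(16 * t * (L - v) ^ 2 / L ^ 2))
  by_cases hv : 2 * v ≤ L
  · -- first half: `sin (πv/L) ≥ 2v/L`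
    have h1 : 2 * v / L ≤ Real.sin (π * v / L) := by
      have hx : 0 ≤ π * v / L := by positivity
      have hx' : π * v / L ≤ π / 2 := by
        rw [div_le_div_iff₀ hL two_pos]
        nlinarith [Real.pi_pos]
      have := Real.mul_le_sin hx hx'
      calc 2 * v / L = 2 / π * (π * v / L) := by field_simp
        _ ≤ Real.sin (π * v / L) := this
    have h2 : (2 * v / L) ^ 2 ≤ Real.sin (π * v / L) ^ 2 :=
      pow_le_pow_left₀ (by positivity) h1 2
    have h3 : Real.exp (-(4 * t * Real.sin (π * v / L) ^ 2)) ≤ Real.exp (-(16 * t * v ^ 2 / L ^ 2)) := by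
      apply Real.exp_le_exp.2
      have : 16 * t * v ^ 2 / L ^ 2 = 4 * t * (2 * v / L) ^ 2 := by
        field_simp
        ring
      rw [this, neg_le_neg_iff]
      exact mul_le_mul_of_nonneg_left h2 (by positivity)
    linarith
  · -- second half: `sin (πv/L) = sin (π(L−v)/L) ≥ 2(L−v)/L`
    push Not at hv
    have h1 : 2 * (L - v) / L ≤ Real.sin (π * v / L) := by
      have hx : 0 ≤ π * (L - v) / L := by
        apply div_nonneg _ hL.le
        exact mul_nonneg Real.pi_pos.le (by linarith)
      have hx' : π * (L - v) / L ≤ π / 2 := by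
        rw [div_le_div_iff₀ hL two_pos]
        nlinarith [Real.pi_pos]
      have := Real.mul_le_sin hx hx'
      have hsin : Real.sin (π * (L - v) / L) = Real.sin (π * v / L) := by
        rw [show π * (L - v) / L = π - π * v / L by field_simp, Real.sin_pi_sub]
      calc 2 * (L - v) / L = 2 / π * (π * (L - v) / L) := by field_simp
        _ ≤ Real.sin (π * (L - v) / L) := this
        _ = Real.sin (π * v / L) := hsin
    have h2 : (2 * (L - v) / L) ^ 2 ≤ Real.sin (π * v / L) ^ 2 :=
      pow_le_pow_left₀ (div_nonneg (by linarith) hL.le) h1 2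
    have h3 : Real.exp (-(4 * t * Real.sin (π * v / L) ^ 2)) ≤
        Real.exp (-(16 * t * (L - v) ^ 2 / L ^ 2)) := by
      apply Real.exp_le_exp.2
      have : 16 * t * (L - v) ^ 2 / L ^ 2 = 4 * t * (2 * (L - v) / L) ^ 2 := by
        field_simp
        ring
      rw [this, neg_le_neg_iff]
      exact mul_le_mul_of_nonneg_left h2 (by positivity)
    linarith

/-- **One-dimensional upper bound**: for `L ≥ 1` and `1 ≤ t ≤ L²`,
`Σ_{j : ZMod L} e^{−4t sin²(π j.val / L)} ≤ 2 L / √t`. -/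
theorem sum_zmod_exp_upper (L : ℕ) [NeZero L] {t : ℝ} (ht : 1 ≤ t) (htL : t ≤ (L : ℝ) ^ 2) :
    ∑ j : ZMod L, Real.exp (-(4 * t * Real.sin (π * (j.val : ℝ) / L) ^ 2)) ≤ 2 * L / Real.sqrt t := by
  have hL : (0 : ℝ) < L := by exact_mod_cast Nat.pos_of_ne_zero (NeZero.ne L)
  have ht0 : 0 < t := lt_of_lt_of_le one_pos ht
  have hst : 0 < Real.sqrt t := Real.sqrt_pos.2 ht0
  -- pass to representatives and apply the two-sided Jordan bound termwise
  rw [sum_zmod_eq_sum_range]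
  have hterm : ∀ m ∈ Finset.range L,
      Real.exp (-(4 * t * Real.sin (π * (((m : ZMod L)).val : ℝ) / L) ^ 2)) ≤
        Real.exp (-(16 * t * (m : ℝ) ^ 2 / (L : ℝ) ^ 2)) +
          Real.exp (-(16 * t * ((L : ℝ) - m) ^ 2 / (L : ℝ) ^ 2)) := by
    intro m hm
    have hmL : m < L := Finset.mem_range.mp hm
    rw [ZMod.val_cast_of_lt hmL]
    exact exp_neg_sin_sq_le hL (Nat.cast_nonneg m) (by exact_mod_cast hmL.le) ht0.le
  refine (Finset.sum_le_sum hterm).trans ?_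
  rw [Finset.sum_add_distrib]
  -- the Gaussian sum with `s = 16 t / L²`
  have hs : 0 < 16 * t / (L : ℝ) ^ 2 := by positivity
  have hgauss : ∑ m ∈ Finset.range L, Real.exp (-(16 * t / (L : ℝ) ^ 2 * ((m : ℝ) + 1) ^ 2)) ≤
      √π * L / (8 * Real.sqrt t) := by
    refine (sum_range_exp_neg_mul_sq_succ_le hs L).trans (le_of_eq ?_)
    rw [Real.sqrt_div' _ (by positivity), Real.sqrt_sq hL.le,
      show (16 : ℝ) * t = 4 ^ 2 * t by norm_num, Real.sqrt_mul' _ ht0.le, Real.sqrt_sq (by norm_num)]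
    field_simp
    ring
  -- first sum: the `m = 0` term is `1`, the rest is a shifted Gaussian sum
  have hA : ∑ m ∈ Finset.range L, Real.exp (-(16 * t * (m : ℝ) ^ 2 / (L : ℝ) ^ 2)) ≤
      1 + √π * L / (8 * Real.sqrt t) := by
    obtain ⟨L', hL'⟩ : ∃ L', L = L' + 1 := Nat.exists_eq_succ_of_ne_zero (NeZero.ne L)
    rw [show Finset.range L = Finset.range (L' + 1) by rw [hL'], Finset.sum_range_succ']
    simp only [Nat.cast_zero, ne_eq, OfNat.ofNat_ne_zero, not_false_eq_true, zero_pow, mul_zero,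
      zero_div, neg_zero, Real.exp_zero]
    rw [add_comm]
    gcongr
    calc ∑ m ∈ Finset.range L', Real.exp (-(16 * t * ((m + 1 : ℕ) : ℝ) ^ 2 / (L : ℝ) ^ 2))
        = ∑ m ∈ Finset.range L', Real.exp (-(16 * t / (L : ℝ) ^ 2 * ((m : ℝ) + 1) ^ 2)) := by
          refine Finset.sum_congr rfl fun m _ => ?_
          push_cast
          ring_nf
      _ ≤ ∑ m ∈ Finset.range L, Real.exp (-(16 * t / (L : ℝ) ^ 2 * ((m : ℝ) + 1) ^ 2)) := by
          apply Finset.sum_le_sum_of_subset_of_nonneg (Finset.range_mono (by omega))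
          intro i _ _
          exact (Real.exp_pos _).le
      _ ≤ √π * L / (8 * Real.sqrt t) := hgauss
  -- second sum: reflect `m ↦ L − 1 − m`
  have hB : ∑ m ∈ Finset.range L, Real.exp (-(16 * t * ((L : ℝ) - m) ^ 2 / (L : ℝ) ^ 2)) ≤
      √π * L / (8 * Real.sqrt t) := by
    rw [← Finset.sum_range_reflect]
    refine le_of_eq_of_le (Finset.sum_congr rfl fun m hm => ?_) hgauss
    have hmL : m < L := Finset.mem_range.mp hm
    have : ((L - 1 - m : ℕ) : ℝ) = (L : ℝ) - 1 - m := by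
      rw [Nat.cast_sub (by omega), Nat.cast_sub (by omega), Nat.cast_one]
    rw [this]
    ring_nf
  -- `1 ≤ L / √t` since `t ≤ L²`
  have hsqrt : Real.sqrt t ≤ L := by
    rw [Real.sqrt_le_left hL.le]
    exact htL
  have h1 : (1 : ℝ) ≤ L / Real.sqrt t := by
    rw [le_div_iff₀ hst, one_mul]
    exact hsqrt
  have hπ : √π ≤ 2 := by
    rw [Real.sqrt_le_left (by norm_num)]
    linarith [Real.pi_lt_four]
  calc ∑ m ∈ Finset.range L, Real.exp (-(16 * t * (m : ℝ) ^ 2 / (L : ℝ) ^ 2)) +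
        ∑ m ∈ Finset.range L, Real.exp (-(16 * t * ((L : ℝ) - m) ^ 2 / (L : ℝ) ^ 2))
      ≤ (1 + √π * L / (8 * Real.sqrt t)) + √π * L / (8 * Real.sqrt t) := add_le_add hA hB
    _ = 1 + √π / 4 * (L / Real.sqrt t) := by ring
    _ ≤ L / Real.sqrt t + 2 / 4 * (L / Real.sqrt t) := by gcongr
    _ ≤ 2 * L / Real.sqrt t := by
        rw [mul_div_assoc]
        nlinarith

/-! ### Lower bound: the small momenta -/

/-- `g(θ) = 4(1 − cos θ)² + sin² θ ≤ θ⁴ + θ²`. -/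
theorem four_mul_one_sub_cos_sq_add_sin_sq_le (θ : ℝ) :
    4 * (1 - Real.cos θ) ^ 2 + Real.sin θ ^ 2 ≤ θ ^ 4 + θ ^ 2 := by
  have h1 : 0 ≤ 1 - Real.cos θ := sub_nonneg.2 (Real.cos_le_one θ)
  have h2 : 1 - Real.cos θ ≤ θ ^ 2 / 2 := by linarith [Real.one_sub_sq_div_two_le_cos (x := θ)]
  have h3 : (1 - Real.cos θ) ^ 2 ≤ (θ ^ 2 / 2) ^ 2 := pow_le_pow_left₀ h1 h2 2
  have h4 : Real.sin θ ^ 2 ≤ θ ^ 2 := Real.sin_sq_le_sq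
  nlinarith

/-- **One-dimensional lower bound**: for `L ≥ 1` and `1 ≤ t`,
`e^{−2} · L / (2π √t) ≤ Σ_{j : ZMod L} e^{−t (4(1 − cos θ_j)² + sin² θ_j)}`, `θ_j = 2π j.val / L`. -/
theorem sum_zmod_exp_lower (L : ℕ) [NeZero L] {t : ℝ} (ht : 1 ≤ t) :
    Real.exp (-2) * (L / (2 * π * Real.sqrt t)) ≤
      ∑ j : ZMod L, Real.exp (-(t * (4 * (1 - Real.cos (2 * π * (j.val : ℝ) / L)) ^ 2 +
        Real.sin (2 * π * (j.val : ℝ) / L) ^ 2))) := by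
  have hL : (0 : ℝ) < L := by exact_mod_cast Nat.pos_of_ne_zero (NeZero.ne L)
  have ht0 : 0 < t := lt_of_lt_of_le one_pos ht
  have hst : 0 < Real.sqrt t := Real.sqrt_pos.2 ht0
  have hst1 : 1 ≤ Real.sqrt t := by rw [Real.le_sqrt' one_pos, one_pow]; exact ht
  have hsqt : Real.sqrt t ^ 2 = t := Real.sq_sqrt ht0.le
  -- the number of small momenta
  set N : ℕ := ⌊(L : ℝ) / (2 * π * Real.sqrt t)⌋₊ with hN
  have hy0 : 0 ≤ (L : ℝ) / (2 * π * Real.sqrt t) := by positivity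
  have hNle : (N : ℝ) ≤ (L : ℝ) / (2 * π * Real.sqrt t) := Nat.floor_le hy0
  have hNlt : (L : ℝ) / (2 * π * Real.sqrt t) < N + 1 := Nat.lt_floor_add_one _
  -- `min (N+1) L` terms, each at least `e^{-2}`
  set M : ℕ := min (N + 1) L with hM
  have hML : M ≤ L := min_le_right _ _
  have hMge : (L : ℝ) / (2 * π * Real.sqrt t) ≤ M := by
    rcases Nat.le_total (N + 1) L with h | h
    · rw [hM, min_eq_left h]; push_cast; exact hNlt.le
    · rw [hM, min_eq_right h]
      calc (L : ℝ) / (2 * π * Real.sqrt t) ≤ (L : ℝ) / 1 := by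
            apply div_le_div_of_nonneg_left hL.le one_pos
            nlinarith [Real.pi_gt_three]
        _ = L := div_one _
  rw [sum_zmod_eq_sum_range]
  have hterm : ∀ m ∈ Finset.range M,
      Real.exp (-2) ≤ Real.exp (-(t * (4 * (1 - Real.cos (2 * π * (((m : ZMod L)).val : ℝ) / L)) ^ 2 +
        Real.sin (2 * π * (((m : ZMod L)).val : ℝ) / L) ^ 2))) := by
    intro m hm
    have hmM : m < M := Finset.mem_range.mp hm
    have hmL : m < L := lt_of_lt_of_le hmM hML
    have hmN : (m : ℝ) ≤ N := by exact_mod_cast Nat.lt_succ_iff.mp (lt_of_lt_of_le hmM (min_le_left _ _))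
    rw [ZMod.val_cast_of_lt hmL]
    apply Real.exp_le_exp.2
    rw [neg_le_neg_iff]
    set θ : ℝ := 2 * π * (m : ℝ) / L with hθ
    have hθ0 : 0 ≤ θ := by positivity
    have hθle : θ ≤ 1 / Real.sqrt t := by
      have : (m : ℝ) ≤ (L : ℝ) / (2 * π * Real.sqrt t) := hmN.trans hNle
      rw [hθ, div_le_div_iff₀ hL hst]
      rw [le_div_iff₀ (by positivity)] at this
      nlinarith
    have hθ1 : θ ≤ 1 := hθle.trans (by rw [div_le_one hst]; exact hst1)
    have hθ2 : θ ^ 2 ≤ 1 / t := by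
      calc θ ^ 2 ≤ (1 / Real.sqrt t) ^ 2 := pow_le_pow_left₀ hθ0 hθle 2
        _ = 1 / t := by rw [div_pow, one_pow, hsqt]
    have hθ4 : θ ^ 4 ≤ 1 / t := by
      calc θ ^ 4 = θ ^ 2 * θ ^ 2 := by ring
        _ ≤ 1 * (1 / t) := by
            apply mul_le_mul _ hθ2 (by positivity) zero_le_one
            calc θ ^ 2 ≤ 1 ^ 2 := pow_le_pow_left₀ hθ0 hθ1 2
              _ = 1 := one_pow 2
        _ = 1 / t := one_mul _
    calc t * (4 * (1 - Real.cos θ) ^ 2 + Real.sin θ ^ 2) ≤ t * (θ ^ 4 + θ ^ 2) :=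
          mul_le_mul_of_nonneg_left (four_mul_one_sub_cos_sq_add_sin_sq_le θ) ht0.le
      _ ≤ t * (1 / t + 1 / t) := by gcongr
      _ = 2 := by field_simp; ring
  calc Real.exp (-2) * (L / (2 * π * Real.sqrt t)) ≤ Real.exp (-2) * M :=
        mul_le_mul_of_nonneg_left hMge (Real.exp_pos _).le
    _ = ∑ m ∈ Finset.range M, Real.exp (-2) := by
        rw [Finset.sum_const, Finset.card_range, nsmul_eq_mul, mul_comm]
    _ ≤ ∑ m ∈ Finset.range M, Real.exp (-(t * (4 * (1 - Real.cos (2 * π * (((m : ZMod L)).val : ℝ) / L)) ^ 2 +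
        Real.sin (2 * π * (((m : ZMod L)).val : ℝ) / L) ^ 2))) := Finset.sum_le_sum hterm
    _ ≤ ∑ m ∈ Finset.range L, Real.exp (-(t * (4 * (1 - Real.cos (2 * π * (((m : ZMod L)).val : ℝ) / L)) ^ 2 +
        Real.sin (2 * π * (((m : ZMod L)).val : ℝ) / L) ^ 2))) := by
        apply Finset.sum_le_sum_of_subset_of_nonneg (Finset.range_mono hML)
        intro i _ _
        exact (Real.exp_pos _).le

end

end Summit.QuantumFields.QCD.Theorems.HeatSlicedQuarks.FreeKernel
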